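import Summits.RiemannHypothesis.RiemannHypothesis.Theorems.PfPersistenceFfGram

/-!
# Motivic door, function-field side (C)(i), part 1: the CONVERSE Weil criterion for the window tower
(pub-rhdoor seat ff-1.  HONEST FRAMING: lottery ticket at the motivic door; RH probability negligible;
consolation prizes are real — this file is one: the analytic half of the ff-door theorem (i).  No claim
about `ζ`; "RH" below is always the function-field Riemann hypothesis `|α| = √q` for the roots of ONE
integer polynomial, a HYPOTHESIS or a CONCLUSION of a theorem about that polynomial.)

Setting (pub-rhpf ffmirror-2, `PfPersistenceFfAngleTwin` / `PfPersistenceFfGram`): a datum `(q, h)`,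
`h ∈ ℤ[X]` the characteristic polynomial of Frobenius (degree `2g`, roots `α_j`), its window tower
`M ↦ T_M(q,h) = (K(|m-m'|))_{m,m' ≤ M}`, `K(n) = ½ Σ_j (α_j/√q)^n` (`ffKernel`, `weilWindowForm`).
ffmirror-2 PROVED the positivity half `RH(q,h) ⇒ ∀ M, T_M(q,h) ⪰ 0` (`weilWindowForm_posSemidef`,
715cc99784cc) and recorded the converse as OPEN in the tree (FF-DOOR-QUANTIFIERS.md, D-D).  Here:

* `norm_le_one_of_powerSum_bounded` — CORE LEMMA [folklore]: if the power sums `s_n(U)` of a finite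
  multiset `U ⊂ ℂ` are bounded in `n`, every `u ∈ U` has `|u| ≤ 1` (annihilating-polynomial proof:
  `Σ_u u^n P(u) = m(u₀) u₀^n P(u₀)` for `P = ∏_{w ≠ u₀} (X - w)`, so `|u₀|^n` is bounded).
* `frobRoots_reciprocal` — the FUNCTIONAL EQUATION of an honest datum, typed on coefficients as
  `q^g · c_j = q^i · c_i` whenever `i + j = 2g` (`c_k = h.coeff k`; for `g = 1`: `h = X² - tX + q`), forces
  `c_0 ≠ 0` and closes the root multiset under `α ↦ q/α` [folklore].
* `ffRH_of_ffKernel_bounded` — CONVERSE WEIL CRITERION (kernel form): FE + `K(n)` bounded ⇒ RH(q,h);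
  `ffRH_of_ffKernel_norm_le` (minor form `|K(n)| ≤ K(0)`, i.e. the classical `|s_n| ≤ 2g q^{n/2}`);
  `ffRH_of_weilWindowForm_posSemidef` (positivity form, via the `2 × 2` principal minors `{0, n}`);
  with ffmirror-2's half: `weilWindowForm_posSemidef_iff_ffRH` — THE WINDOW TOWER CARRIES EXACTLY RH.
  The FE is load-bearing: without it `(q,h) = (4, (X-1)²)` has every window positive definite
  (ffmirror-2) and `U = {r,r}`, `0 < r < 1`, has bounded power sums.

Design: `q : ℕ`, `0 < q` (no primality); FE and RH are INLINE hypotheses (a `def … : Prop` in a Summits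
helper would be a vendored fact); nothing here mentions realizability / abelian varieties — that enters
only in part 2 (`MotivicDoorFfDoor`) as explicit Honda–Tate / Weil hypotheses on an abstract predicate.
-/

set_option linter.dupNamespace false

noncomputable section

open Polynomial
open scoped ComplexOrder

open Summit.RiemannHypothesis.RiemannHypothesis.Theorems.PfPersistence.FfAngleTwin

namespace Summit.RiemannHypothesis.RiemannHypothesis.Theorems.MotivicDoor.FunctionField

/-! ## A. Bounded power sums force the roots into the closed unit disc -/

/-- `s_m(a ::ₘ U) = a^m + s_m(U)`. [folklore] -/
theorem powerSum_cons (a : ℂ) (U : Multiset ℂ) (m : ℕ) :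
    powerSum (a ::ₘ U) m = a ^ m + powerSum U m := by
  simp [powerSum]

/-- Interchange of summations: `Σ_{u ∈ U} u^n · P(u) = Σ_i P_i · s_{n+i}(U)`. [folklore] -/
theorem multiset_sum_pow_mul_eval (U : Multiset ℂ) (P : ℂ[X]) (n : ℕ) :
    (U.map fun u => u ^ n * P.eval u).sum
      = ∑ i ∈ Finset.range (P.natDegree + 1), P.coeff i * powerSum U (n + i) := by
  induction U using Multiset.induction_on with
  | empty => simp [powerSum]
  | cons a U ih =>
    simp only [Multiset.map_cons, Multiset.sum_cons, powerSum_cons, mul_add, Finset.sum_add_distrib, ih]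
    congr 1
    rw [eval_eq_sum_range, Finset.mul_sum]
    exact Finset.sum_congr rfl fun i _ => by rw [pow_add]; ring

/-- … hence bounded power sums bound `Σ_{u ∈ U} u^n · P(u)` uniformly in `n`. [folklore] -/
theorem norm_multiset_sum_pow_mul_eval_le {U : Multiset ℂ} {B : ℝ} (hb : ∀ n, ‖powerSum U n‖ ≤ B)
    (P : ℂ[X]) (n : ℕ) :
    ‖(U.map fun u => u ^ n * P.eval u).sum‖
      ≤ (∑ i ∈ Finset.range (P.natDegree + 1), ‖P.coeff i‖) * B := by
  rw [multiset_sum_pow_mul_eval, Finset.sum_mul]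
  refine (norm_sum_le _ _).trans (Finset.sum_le_sum fun i _ => ?_)
  rw [norm_mul]
  exact mul_le_mul_of_nonneg_left (hb _) (norm_nonneg _)

/-- If `P` vanishes at every element of `U` other than `u₀`, then `Σ_{u ∈ U} u^n P(u) = m(u₀) · u₀^n P(u₀)`
(`m(u₀)` the multiplicity of `u₀` in `U`). [folklore] -/
theorem multiset_sum_pow_mul_eval_of_vanish (U : Multiset ℂ) (u₀ : ℂ) {P : ℂ[X]}
    (hP : ∀ u ∈ U, ¬ u = u₀ → P.eval u = 0) (n : ℕ) :
    (U.map fun u => u ^ n * P.eval u).sum = (U.count u₀ : ℂ) * (u₀ ^ n * P.eval u₀) := by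
  conv_lhs => rw [← Multiset.filter_add_not (· = u₀) U]
  rw [Multiset.map_add, Multiset.sum_add, Multiset.filter_eq', Multiset.map_replicate,
    Multiset.sum_replicate, nsmul_eq_mul]
  have h0 : ((U.filter fun a => ¬ a = u₀).map fun u => u ^ n * P.eval u).sum = 0 := by
    refine Multiset.sum_eq_zero fun x hx => ?_
    obtain ⟨u, hu, rfl⟩ := Multiset.mem_map.1 hx
    obtain ⟨huU, hne⟩ := Multiset.mem_filter.1 hu
    rw [hP u huU hne, mul_zero]
  rw [h0, add_zero]

/-- The annihilator `∏_{w ∈ U, w ≠ u₀} (X - w)` vanishes on `U ∖ {u₀}` … [folklore] -/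
theorem eval_annihilator_eq_zero (U : Multiset ℂ) (u₀ : ℂ) :
    ∀ u ∈ U, ¬ u = u₀ → (((U.filter fun w => ¬ w = u₀).map fun w => X - C w).prod).eval u = 0 := by
  intro u hu hne
  rw [eval_multiset_prod, Multiset.prod_eq_zero_iff]
  refine Multiset.mem_map.2 ⟨X - C u, Multiset.mem_map.2 ⟨u, Multiset.mem_filter.2 ⟨hu, hne⟩, rfl⟩, ?_⟩
  simp

/-- … and not at `u₀`. [folklore] -/
theorem eval_annihilator_ne_zero (U : Multiset ℂ) (u₀ : ℂ) :
    (((U.filter fun w => ¬ w = u₀).map fun w => X - C w).prod).eval u₀ ≠ 0 := by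
  rw [eval_multiset_prod, Multiset.map_map, Ne, Multiset.prod_eq_zero_iff]
  intro h
  obtain ⟨w, hw, h0⟩ := Multiset.mem_map.1 h
  simp only [Function.comp_apply, eval_sub, eval_X, eval_C] at h0
  exact (Multiset.mem_filter.1 hw).2 (sub_eq_zero.1 h0).symm

/-- CORE LEMMA.  If the power sums `s_n(U) = Σ_{u ∈ U} u^n` of a finite multiset `U ⊂ ℂ` are bounded in
`n`, then `|u| ≤ 1` for every `u ∈ U`. [folklore] -/
theorem norm_le_one_of_powerSum_bounded {U : Multiset ℂ} {B : ℝ} (hb : ∀ n, ‖powerSum U n‖ ≤ B) :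
    ∀ u ∈ U, ‖u‖ ≤ 1 := by
  intro u₀ hu₀
  by_contra hgt
  have hgt : 1 < ‖u₀‖ := not_le.1 hgt
  set P : ℂ[X] := ((U.filter fun w => ¬ w = u₀).map fun w => X - C w).prod with hPdef
  have hPu : P.eval u₀ ≠ 0 := eval_annihilator_ne_zero U u₀
  have hcnt : (1 : ℝ) ≤ (U.count u₀ : ℝ) := by exact_mod_cast Multiset.one_le_count_iff_mem.2 hu₀
  set A : ℝ := (∑ i ∈ Finset.range (P.natDegree + 1), ‖P.coeff i‖) * B with hAdef
  have key : ∀ n, ((U.count u₀ : ℝ) * ‖P.eval u₀‖) * ‖u₀‖ ^ n ≤ A := by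
    intro n
    have h1 := norm_multiset_sum_pow_mul_eval_le hb P n
    rw [multiset_sum_pow_mul_eval_of_vanish U u₀ (eval_annihilator_eq_zero U u₀) n, norm_mul, norm_mul,
      norm_pow, Complex.norm_natCast] at h1
    calc ((U.count u₀ : ℝ) * ‖P.eval u₀‖) * ‖u₀‖ ^ n = (U.count u₀ : ℝ) * (‖u₀‖ ^ n * ‖P.eval u₀‖) := by
          ring
      _ ≤ A := h1
  have hpos : 0 < (U.count u₀ : ℝ) * ‖P.eval u₀‖ :=
    mul_pos (by linarith) (norm_pos_iff.2 hPu)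
  obtain ⟨n, hn⟩ := pow_unbounded_of_one_lt (A / ((U.count u₀ : ℝ) * ‖P.eval u₀‖)) hgt
  have h2 : ‖u₀‖ ^ n ≤ A / ((U.count u₀ : ℝ) * ‖P.eval u₀‖) := by
    rw [le_div_iff₀ hpos, mul_comm]; exact key n
  exact absurd (lt_of_lt_of_le hn h2) (lt_irrefl _)

/-- UNIT-CIRCLE CRITERION (multiset level, no `q`): a finite multiset `U ⊂ ℂ ∖ {0}` closed under
`u ↦ u⁻¹` has bounded power sums iff it lies on the unit circle — the `if` direction. [folklore] -/
theorem norm_eq_one_of_powerSum_bounded {U : Multiset ℂ} (h0 : (0 : ℂ) ∉ U)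
    (hinv : ∀ u ∈ U, u⁻¹ ∈ U) {B : ℝ} (hb : ∀ n, ‖powerSum U n‖ ≤ B) : ∀ u ∈ U, ‖u‖ = 1 := by
  intro u hu
  have hu0 : u ≠ 0 := fun h => h0 (h ▸ hu)
  refine le_antisymm (norm_le_one_of_powerSum_bounded hb u hu) ?_
  have h1 := norm_le_one_of_powerSum_bounded hb u⁻¹ (hinv u hu)
  rw [norm_inv] at h1
  exact (inv_le_one₀ (norm_pos_iff.2 hu0)).1 h1

/-! ## B. The functional equation of an honest datum: `q^g c_j = q^i c_i` for `i + j = 2g` -/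

/-- FE transported to `ℂ`. [folklore] -/
theorem fe_complex {q : ℕ} {h : ℤ[X]} {g : ℕ}
    (hFE : ∀ i j, i + j = 2 * g → (q : ℤ) ^ g * h.coeff j = (q : ℤ) ^ i * h.coeff i)
    {i j : ℕ} (hij : i + j = 2 * g) :
    (q : ℂ) ^ g * (h.map (Int.castRingHom ℂ)).coeff j = (q : ℂ) ^ i * (h.map (Int.castRingHom ℂ)).coeff i := by
  rw [Polynomial.coeff_map, Polynomial.coeff_map, eq_intCast, eq_intCast]
  exact_mod_cast hFE i j hij

/-- FE forces the constant coefficient: `c_0 = q^g · c_{2g}`; in particular `c_0 ≠ 0` when `h ≠ 0`. [folklore] -/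
theorem coeff_zero_ne_zero_of_fe {q : ℕ} (hq : 0 < q) {h : ℤ[X]} {g : ℕ} (hdeg : h.natDegree = 2 * g)
    (hh0 : h ≠ 0) (hFE : ∀ i j, i + j = 2 * g → (q : ℤ) ^ g * h.coeff j = (q : ℤ) ^ i * h.coeff i) :
    h.coeff 0 ≠ 0 := by
  have h1 := hFE (2 * g) 0 (by omega)
  have hlead : h.coeff (2 * g) ≠ 0 := by rw [← hdeg]; exact leadingCoeff_ne_zero.2 hh0
  have hqz : (q : ℤ) ≠ 0 := by exact_mod_cast hq.ne'
  intro h0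
  rw [h0, mul_zero] at h1
  exact (mul_ne_zero (pow_ne_zero _ hqz) hlead) h1.symm

/-- Roots of an honest datum are non-zero. [folklore] -/
theorem frobRoots_ne_zero {q : ℕ} (hq : 0 < q) {h : ℤ[X]} {g : ℕ} (hdeg : h.natDegree = 2 * g)
    (hFE : ∀ i j, i + j = 2 * g → (q : ℤ) ^ g * h.coeff j = (q : ℤ) ^ i * h.coeff i) :
    ∀ α ∈ frobRoots h, α ≠ 0 := by
  intro α hα hα0
  by_cases hh0 : h = 0
  · simp [frobRoots, hh0] at hα
  have hP0 : h.map (Int.castRingHom ℂ) ≠ 0 := fun h0 => hh0 (Polynomial.map_injective _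
    (Int.castRingHom ℂ).injective_int (by rw [h0, Polynomial.map_zero]))
  have heval := (mem_roots hP0).1 hα
  rw [IsRoot.def, hα0, ← coeff_zero_eq_eval_zero, Polynomial.coeff_map, eq_intCast] at heval
  exact coeff_zero_ne_zero_of_fe hq hdeg hh0 hFE (by exact_mod_cast heval)

/-- THE FUNCTIONAL EQUATION CLOSES THE ROOTS UNDER `α ↦ q/α`:  if `h(α) = 0` then `h(q/α) = 0`
(`α^{2g} q^g h(q/α) = q^{2g} h(α)` by reflecting the coefficient sum). [folklore] -/
theorem frobRoots_reciprocal {q : ℕ} (hq : 0 < q) {h : ℤ[X]} {g : ℕ} (hdeg : h.natDegree = 2 * g)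
    (hFE : ∀ i j, i + j = 2 * g → (q : ℤ) ^ g * h.coeff j = (q : ℤ) ^ i * h.coeff i) :
    ∀ α ∈ frobRoots h, (q : ℂ) / α ∈ frobRoots h := by
  intro α hα
  have hα0 : α ≠ 0 := frobRoots_ne_zero hq hdeg hFE α hα
  by_cases hh0 : h = 0
  · simp [frobRoots, hh0] at hα
  set P : ℂ[X] := h.map (Int.castRingHom ℂ) with hPdef
  have hP0 : P ≠ 0 := fun h0 => hh0 (Polynomial.map_injective _
    (Int.castRingHom ℂ).injective_int (by rw [← hPdef, h0, Polynomial.map_zero]))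
  have hdegP : P.natDegree = 2 * g := by
    rw [hPdef, natDegree_map_eq_of_injective (Int.castRingHom ℂ).injective_int, hdeg]
  have heval : P.eval α = 0 := (mem_roots hP0).1 hα
  have hqC : (q : ℂ) ≠ 0 := by exact_mod_cast hq.ne'
  -- the reflected sum
  have hsum : ∀ x : ℂ, P.eval x = ∑ i ∈ Finset.range (2 * g + 1), P.coeff i * x ^ i := fun x =>
    eval_eq_sum_range' (by rw [hdegP]; exact Nat.lt_succ_self _) x
  have hterm : ∀ i ∈ Finset.range (2 * g + 1),
      P.coeff (2 * g + 1 - 1 - i) * (α ^ (2 * g) * (q : ℂ) ^ g * ((q : ℂ) / α) ^ (2 * g + 1 - 1 - i))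
        = (q : ℂ) ^ (2 * g) * (P.coeff i * α ^ i) := by
    intro i hi
    have hi' : i ≤ 2 * g := by simpa [Finset.mem_range, Nat.lt_succ_iff] using hi
    obtain ⟨k, hk⟩ : ∃ k, i + k = 2 * g := ⟨2 * g - i, by omega⟩
    have hki : 2 * g + 1 - 1 - i = k := by omega
    have hFEk : (q : ℂ) ^ g * P.coeff k = (q : ℂ) ^ i * P.coeff i := fe_complex hFE hk
    rw [hki, ← hk, pow_add, pow_add, div_pow]
    have hαk : α ^ k ≠ 0 := pow_ne_zero _ hα0
    have e1 : α ^ i * α ^ k * (q : ℂ) ^ g * ((q : ℂ) ^ k / α ^ k) = α ^ i * (q : ℂ) ^ g * (q : ℂ) ^ k := by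
      field_simp
    rw [e1]
    linear_combination (α ^ i * (q : ℂ) ^ k) * hFEk
  have hkey : α ^ (2 * g) * (q : ℂ) ^ g * P.eval ((q : ℂ) / α) = (q : ℂ) ^ (2 * g) * P.eval α := by
    rw [hsum, hsum, Finset.mul_sum, Finset.mul_sum, ← Finset.sum_range_reflect _ (2 * g + 1)]
    refine Finset.sum_congr rfl fun i hi => ?_
    rw [← hterm i hi]; ring
  rw [heval, mul_zero] at hkey
  have : P.eval ((q : ℂ) / α) = 0 := by
    have hne : α ^ (2 * g) * (q : ℂ) ^ g ≠ 0 := mul_ne_zero (pow_ne_zero _ hα0) (pow_ne_zero _ hqC)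
    exact (mul_eq_zero.1 hkey).resolve_left hne
  exact (mem_roots hP0).2 this

/-! ## C. The converse Weil criterion -/

/-- `s_n(A/√q) = 2 K(n)`. [folklore] -/
theorem powerSum_normRoots_eq (q : ℝ) (A : Multiset ℂ) (n : ℕ) :
    powerSum (normRoots q A) n = 2 * ffKernel q A n := by
  unfold ffKernel; ring

/-- CONVERSE WEIL CRITERION (kernel form).  For an honest datum — `h ∈ ℤ[X]` of degree `2g` satisfying the
functional equation — boundedness of the Toeplitz symbol `K(n)` of its window tower forces the
function-field Riemann hypothesis `|α| = √q` for every root. [folklore] -/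
theorem ffRH_of_ffKernel_bounded {q : ℕ} (hq : 0 < q) {h : ℤ[X]} {g : ℕ} (hdeg : h.natDegree = 2 * g)
    (hFE : ∀ i j, i + j = 2 * g → (q : ℤ) ^ g * h.coeff j = (q : ℤ) ^ i * h.coeff i)
    {B : ℝ} (hb : ∀ n, ‖ffKernel (q : ℝ) (frobRoots h) n‖ ≤ B) :
    ∀ α ∈ frobRoots h, ‖α‖ = Real.sqrt q := by
  have hqR : (0 : ℝ) < q := by exact_mod_cast hq
  have hs : 0 < Real.sqrt q := Real.sqrt_pos.2 hqR
  have hsC : (Real.sqrt q : ℂ) ≠ 0 := by exact_mod_cast hs.ne'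
  -- bounded normalised power sums ⇒ every normalised root in the closed unit disc
  have hb2 : ∀ n, ‖powerSum (normRoots (q : ℝ) (frobRoots h)) n‖ ≤ 2 * B := fun n => by
    rw [powerSum_normRoots_eq, norm_mul, RCLike.norm_ofNat]
    exact mul_le_mul_of_nonneg_left (hb n) (by norm_num)
  have hle : ∀ α ∈ frobRoots h, ‖α‖ ≤ Real.sqrt q := by
    intro α hα
    have hu := norm_le_one_of_powerSum_bounded hb2 (α / (Real.sqrt q : ℂ))
      (Multiset.mem_map.2 ⟨α, hα, rfl⟩)
    rw [norm_div, Complex.norm_real, Real.norm_eq_abs, abs_of_pos hs, div_le_one hs] at hu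
    exact hu
  intro α hα
  refine le_antisymm (hle α hα) ?_
  -- the reciprocal root `q/α` is also in the disc of radius `√q`
  have hα0 : α ≠ 0 := frobRoots_ne_zero hq hdeg hFE α hα
  have hrec := hle _ (frobRoots_reciprocal hq hdeg hFE α hα)
  rw [norm_div, Complex.norm_natCast, div_le_iff₀ (norm_pos_iff.2 hα0)] at hrec
  have h3 : Real.sqrt q * Real.sqrt q ≤ Real.sqrt q * ‖α‖ := by
    rw [Real.mul_self_sqrt hqR.le]; exact hrec
  exact le_of_mul_le_mul_left h3 hs

/-- CONVERSE WEIL CRITERION (minor form = the classical statement `|s_n| ≤ 2g q^{n/2} ∀ n ⇒ RH`):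
`|K(n)| ≤ K(0)` for all `n` (the `2 × 2` principal minors `{0,n}` of the tower) forces RH. [folklore] -/
theorem ffRH_of_ffKernel_norm_le {q : ℕ} (hq : 0 < q) {h : ℤ[X]} {g : ℕ} (hdeg : h.natDegree = 2 * g)
    (hFE : ∀ i j, i + j = 2 * g → (q : ℤ) ^ g * h.coeff j = (q : ℤ) ^ i * h.coeff i)
    (hmin : ∀ n, ‖ffKernel (q : ℝ) (frobRoots h) n‖ ≤ ‖ffKernel (q : ℝ) (frobRoots h) 0‖) :
    ∀ α ∈ frobRoots h, ‖α‖ = Real.sqrt q :=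
  ffRH_of_ffKernel_bounded hq hdeg hFE hmin

/-- FORWARD minor bound: RH ⇒ `|K(n)| ≤ K(0) = g` (triangle inequality; no FE needed). [folklore] -/
theorem ffKernel_norm_le_of_ffRH {q : ℝ} (hq : 0 < q) {A : Multiset ℂ}
    (hRH : ∀ α ∈ A, ‖α‖ = Real.sqrt q) (n : ℕ) :
    ‖ffKernel q A n‖ ≤ ‖ffKernel q A 0‖ := by
  have hmod := normRoots_norm_eq_one hq hRH
  have h0 : ‖ffKernel q A 0‖ = (Multiset.card A : ℝ) / 2 := by
    rw [ffKernel_zero, norm_div, Complex.norm_natCast, RCLike.norm_ofNat]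
  rw [h0]
  unfold ffKernel
  rw [norm_div, RCLike.norm_ofNat]
  gcongr
  unfold powerSum
  refine (norm_multiset_sum_le _).trans (le_of_eq ?_)
  rw [Multiset.map_map]
  have : (normRoots q A).map ((fun x => ‖x‖) ∘ fun α : ℂ => α ^ n) = (normRoots q A).map fun _ => (1 : ℝ) := by
    refine Multiset.map_congr rfl fun z hz => ?_
    simp only [Function.comp_apply, norm_pow, hmod z hz, one_pow]
  rw [this, Multiset.map_const', Multiset.sum_replicate, card_normRoots, nsmul_eq_mul, mul_one]

/-- The symbol of a Hermitian window form is real: `T_n ⪰ 0 ⇒ K(n) ∈ ℝ`. [folklore] -/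
theorem ffKernel_im_eq_zero_of_posSemidef {q : ℝ} {A : Multiset ℂ} {n : ℕ}
    (hpsd : (ffWindowForm q A n).PosSemidef) : (ffKernel q A n).im = 0 := by
  have hH := hpsd.isHermitian.apply (0 : Fin (n + 1)) (Fin.last n)
  simp only [ffWindowForm, Matrix.of_apply, Fin.val_zero, Fin.val_last, Nat.dist_zero_left,
    Nat.dist_zero_right] at hH
  exact Complex.conj_eq_iff_im.1 hH

/-- `2 × 2` MINORS: `T_n ⪰ 0 ⇒ |K(n)| ≤ K(0)` (principal minor on rows/columns `{0, n}`). [folklore] -/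
theorem ffKernel_norm_le_of_posSemidef {q : ℝ} {A : Multiset ℂ} {n : ℕ}
    (hpsd : (ffWindowForm q A n).PosSemidef) : ‖ffKernel q A n‖ ≤ ‖ffKernel q A 0‖ := by
  have him := ffKernel_im_eq_zero_of_posSemidef hpsd
  -- the principal `2 × 2` minor on `{0, last}`
  have hdet := (hpsd.submatrix ![(0 : Fin (n + 1)), Fin.last n]).det_nonneg
  rw [Matrix.det_fin_two] at hdet
  simp only [Matrix.submatrix_apply, Matrix.cons_val_zero, Matrix.cons_val_one,
    ffWindowForm, Matrix.of_apply, Fin.val_zero, Fin.val_last, Nat.dist_zero_left, Nat.dist_zero_right,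
    Nat.dist_self] at hdet
  -- `K(0) = #A/2` is a nonnegative real, `K(n)` is real
  have hK0 : ffKernel q A 0 = ((Multiset.card A : ℝ) / 2 : ℝ) := by
    rw [ffKernel_zero]; push_cast; ring
  set x : ℝ := (ffKernel q A n).re with hx
  have hKn : ffKernel q A n = (x : ℂ) := by
    apply Complex.ext <;> simp [hx, him]
  rw [hK0, hKn] at hdet ⊢
  rw [Complex.norm_real, Complex.norm_real, Real.norm_eq_abs, Real.norm_eq_abs,
    abs_of_nonneg (by positivity : (0 : ℝ) ≤ (Multiset.card A : ℝ) / 2)]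
  have hdet' : (0 : ℝ) ≤ (Multiset.card A : ℝ) / 2 * ((Multiset.card A : ℝ) / 2) - x * x := by
    have := (Complex.le_def.1 hdet).1
    simpa using this
  exact abs_le_of_sq_le_sq (by rw [sq, sq]; linarith [hdet']) (by positivity)

/-- CONVERSE WEIL CRITERION (positivity form): for an honest datum, positivity of EVERY window form
`T_M(q,h) ⪰ 0` forces RH(q,h). [folklore] -/
theorem ffRH_of_weilWindowForm_posSemidef {q : ℕ} (hq : 0 < q) {h : ℤ[X]} {g : ℕ}
    (hdeg : h.natDegree = 2 * g)
    (hFE : ∀ i j, i + j = 2 * g → (q : ℤ) ^ g * h.coeff j = (q : ℤ) ^ i * h.coeff i)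
    (hpsd : ∀ M, (weilWindowForm (q : ℝ) h M).PosSemidef) :
    ∀ α ∈ frobRoots h, ‖α‖ = Real.sqrt q :=
  ffRH_of_ffKernel_norm_le hq hdeg hFE fun n => ffKernel_norm_le_of_posSemidef (hpsd n)

/-- THE WINDOW TOWER CARRIES EXACTLY RH (ffmirror-2's positivity half + the converse above): for an honest
datum `(q, h)`, `(∀ M, T_M(q,h) ⪰ 0) ↔ RH(q,h)`. [folklore] -/
theorem weilWindowForm_posSemidef_iff_ffRH {q : ℕ} (hq : 0 < q) {h : ℤ[X]} {g : ℕ}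
    (hdeg : h.natDegree = 2 * g)
    (hFE : ∀ i j, i + j = 2 * g → (q : ℤ) ^ g * h.coeff j = (q : ℤ) ^ i * h.coeff i) :
    (∀ M, (weilWindowForm (q : ℝ) h M).PosSemidef) ↔ ∀ α ∈ frobRoots h, ‖α‖ = Real.sqrt q :=
  ⟨ffRH_of_weilWindowForm_posSemidef hq hdeg hFE,
    fun hRH M => weilWindowForm_posSemidef (by exact_mod_cast hq) hRH M⟩

/-- … and the minor form: `(∀ n, |K(n)| ≤ K(0)) ↔ RH(q,h)` for an honest datum. [folklore] -/
theorem ffKernel_norm_le_iff_ffRH {q : ℕ} (hq : 0 < q) {h : ℤ[X]} {g : ℕ}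
    (hdeg : h.natDegree = 2 * g)
    (hFE : ∀ i j, i + j = 2 * g → (q : ℤ) ^ g * h.coeff j = (q : ℤ) ^ i * h.coeff i) :
    (∀ n, ‖ffKernel (q : ℝ) (frobRoots h) n‖ ≤ ‖ffKernel (q : ℝ) (frobRoots h) 0‖)
      ↔ ∀ α ∈ frobRoots h, ‖α‖ = Real.sqrt q :=
  ⟨ffRH_of_ffKernel_norm_le hq hdeg hFE, fun hRH n => ffKernel_norm_le_of_ffRH (by exact_mod_cast hq) hRH n⟩

end Summit.RiemannHypothesis.RiemannHypothesis.Theorems.MotivicDoor.FunctionField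

end
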